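import Mathlib
import Literature.NumberTheory.Sieve.Maynard2016QSystem
import HarnessLib

/-!
# Maynard (2016), Lemma 7: squarefree linear systems in `q`, prime by prime — p. 12, (Div1)–(Div3)

Trunk: AntSieve / parity (Maynard 2016 large-gaps ladder; named fact
`Literature.NumberTheory.Sieve.Maynard2016.Lemma7Tuple`).

J. Maynard, *Large gaps between primes*, Ann. of Math. 183 (2016) = arXiv:1408.5110, §6, proof of
Lemma 7, p. 12: the moduli `[d_j,d'_j]`, `[e_j,e'_j]` of the `q`-system are squarefree but NOT pairwise
coprime across the `d`/`e` sides; a prime `p` dividing two of them imposes two linear conditions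
`p ∣ P₁ + A₁ q`, `p ∣ P₂ + A₂ q`, which are compatible iff `p ∣ A₂ P₁ − A₁ P₂` — this is the source of
the divisibility constraints (Div1)–(Div3) ("we must also have that `(d_i d_i', e_j e_j') ∣ m p₀(h_i − h_j)
+ h_k − h_i` …") — and "if all of these conditions are satisfied, then the inner sum can be rewritten as
a sum over primes … in a single residue class modulo the least common multiple".

PROVED here, for a finite system `D_t ∣ P_t + A_t q` (`t ∈ s`) with SQUAREFREE moduli and
coefficients `A_t` coprime to `D_t`:
* `intDvd_iff_forall_primeFactors` — a squarefree `D` divides `z` iff every prime of `D` does;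
* `compat_of_intDvd_linear_pair` / `intDvd_linear_of_compat` — two conditions at one prime `p` are
  jointly solvable only if `p ∣ A₂ P₁ − A₁ P₂`, and then they are equivalent;
* `not_linearSystem_of_incompat` — an incompatible prime empties the system;
* `exists_sqfSystem_iff_mod_eq` — under compatibility the system is ONE residue class modulo the
  radical `R = ∏_{p ∣ ∏ D_t} p` (= the least common multiple of the squarefree moduli), via
  `Maynard2016QSystem.exists_linearSystem_iff_mod_eq` applied prime by prime.

## References

* J. Maynard, *Large gaps between primes*, Ann. of Math. (2) 183 (2016), 915–933; arXiv:1408.5110,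
  §6, proof of Lemma 7, p. 12 ((Div1)–(Div3) and the following paragraph). [Maynard2016LargeGaps]
-/

open Finset
open scoped BigOperators

namespace Literature.NumberTheory.Sieve

namespace Maynard2016

/-! ### Squarefree moduli reduce to primes -/

/-- A squarefree `D` divides `z` iff each of its primes does. [folklore] -/
private theorem natDvd_iff_forall_primeFactors {D : ℕ} (hD : Squarefree D) (z : ℤ) :
    (D : ℤ) ∣ z ↔ ∀ p ∈ D.primeFactors, (p : ℤ) ∣ z := by
  constructor
  · intro h p hp
    exact (Int.natCast_dvd_natCast.2 (Nat.dvd_of_mem_primeFactors hp)).trans h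
  · intro h
    have hprod : (∏ p ∈ D.primeFactors, (p : ℤ)) = (D : ℤ) := by
      rw [← Nat.cast_prod, Nat.prod_primeFactors_of_squarefree hD]
    rw [← hprod]
    refine Finset.prod_dvd_of_coprime ?_ h
    intro p hp p' hp' hne
    have hpP := Nat.prime_of_mem_primeFactors (Finset.mem_coe.1 hp)
    have hpP' := Nat.prime_of_mem_primeFactors (Finset.mem_coe.1 hp')
    rw [Function.onFun, Int.isCoprime_iff_gcd_eq_one, Int.gcd_natCast_natCast]
    exact (Nat.coprime_primes hpP hpP').2 hne

/-- **Squarefree reduction**: `D ∣ P + A q` iff `p ∣ P + A q` for every prime `p ∣ D` (`D` squarefree).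
[cite: Maynard2016LargeGaps, Lemma 7 (proof, p. 12)] -/
theorem intDvd_iff_forall_primeFactors {D : ℕ} (hD : Squarefree D) (P A : ℤ) (q : ℕ) :
    (D : ℤ) ∣ P + A * q ↔ ∀ p ∈ D.primeFactors, (p : ℤ) ∣ P + A * q :=
  natDvd_iff_forall_primeFactors hD _

/-! ### Two conditions at one prime -/

/-- **Necessity of (Div)**: `p ∣ P₁ + A₁ q` and `p ∣ P₂ + A₂ q` force `p ∣ A₂ P₁ − A₁ P₂`.
[cite: Maynard2016LargeGaps, Lemma 7 (proof, (Div1)–(Div3))] -/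
theorem compat_of_intDvd_linear_pair {p : ℤ} {P₁ A₁ P₂ A₂ : ℤ} {q : ℕ} (h₁ : p ∣ P₁ + A₁ * q)
    (h₂ : p ∣ P₂ + A₂ * q) : p ∣ A₂ * P₁ - A₁ * P₂ := by
  have : A₂ * P₁ - A₁ * P₂ = A₂ * (P₁ + A₁ * q) - A₁ * (P₂ + A₂ * q) := by ring
  rw [this]
  exact (h₁.mul_left _).sub (h₂.mul_left _)

/-- **Sufficiency of (Div)**: if `p ∣ A₂ P₁ − A₁ P₂` and `A₁` is a unit mod `p`, then
`p ∣ P₁ + A₁ q` implies `p ∣ P₂ + A₂ q`. [cite: Maynard2016LargeGaps, Lemma 7 (proof, (Div1)–(Div3))] -/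
theorem intDvd_linear_of_compat {p : ℤ} {P₁ A₁ P₂ A₂ : ℤ} (hA₁ : IsCoprime A₁ p)
    (hc : p ∣ A₂ * P₁ - A₁ * P₂) {q : ℕ} (h₁ : p ∣ P₁ + A₁ * q) : p ∣ P₂ + A₂ * q := by
  have h : p ∣ A₁ * (P₂ + A₂ * q) := by
    have : A₁ * (P₂ + A₂ * q) = A₂ * (P₁ + A₁ * q) - (A₂ * P₁ - A₁ * P₂) := by ring
    rw [this]
    exact (h₁.mul_left _).sub hc
  exact hA₁.symm.dvd_of_dvd_mul_left h

/-! ### The system -/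

/-- **An incompatible prime empties the `q`-sum** ("the inner sum over `q` is empty unless …").
[cite: Maynard2016LargeGaps, Lemma 7 (proof, (Div1)–(Div3))] -/
theorem not_linearSystem_of_incompat {ι : Type*} (s : Finset ι) (D : ι → ℕ) (P A : ι → ℤ)
    {p : ℕ} {t₁ t₂ : ι} (ht₁ : t₁ ∈ s) (ht₂ : t₂ ∈ s) (hp₁ : p ∣ D t₁) (hp₂ : p ∣ D t₂)
    (hinc : ¬ (p : ℤ) ∣ A t₂ * P t₁ - A t₁ * P t₂) (q : ℕ) :
    ¬ ∀ t ∈ s, (D t : ℤ) ∣ P t + A t * q := by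
  intro h
  apply hinc
  exact compat_of_intDvd_linear_pair
    ((Int.natCast_dvd_natCast.2 hp₁).trans (h t₁ ht₁)) ((Int.natCast_dvd_natCast.2 hp₂).trans (h t₂ ht₂))

/-- The radical of the system: `R = ∏_{p ∣ ∏_t D_t} p`. [cite: Maynard2016LargeGaps, Lemma 7 (proof, p. 12)] -/
theorem prod_primeFactors_pos {ι : Type*} (s : Finset ι) (D : ι → ℕ) :
    0 < ∏ p ∈ (∏ t ∈ s, D t).primeFactors, p :=
  Finset.prod_pos fun _ hp => (Nat.prime_of_mem_primeFactors hp).pos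

/-- **"A single residue class modulo the least common multiple"** for squarefree, compatible systems:
if every `D_t` (`t ∈ s`) is squarefree, `A_t` is coprime to `D_t`, and every prime dividing two moduli
`D_{t₁}, D_{t₂}` satisfies the compatibility `p ∣ A_{t₂} P_{t₁} − A_{t₁} P_{t₂}`, then there is
`c < R = ∏_{p ∣ ∏ D_t} p` with `(∀ t ∈ s, D_t ∣ P_t + A_t q) ↔ q % R = c` for all `q`.
[cite: Maynard2016LargeGaps, Lemma 7 (proof, p. 12)] -/
theorem exists_sqfSystem_iff_mod_eq {ι : Type*} (s : Finset ι) (D : ι → ℕ) (P A : ι → ℤ)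
    (hsq : ∀ t ∈ s, Squarefree (D t)) (hA : ∀ t ∈ s, IsCoprime (A t) (D t : ℤ))
    (hcompat : ∀ p : ℕ, p.Prime → ∀ t₁ ∈ s, ∀ t₂ ∈ s, p ∣ D t₁ → p ∣ D t₂ →
      (p : ℤ) ∣ A t₂ * P t₁ - A t₁ * P t₂) :
    ∃ c, c < ∏ p ∈ (∏ t ∈ s, D t).primeFactors, p ∧
      ∀ q : ℕ, (∀ t ∈ s, (D t : ℤ) ∣ P t + A t * q) ↔
        q % (∏ p ∈ (∏ t ∈ s, D t).primeFactors, p) = c := by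
  classical
  rcases s.eq_empty_or_nonempty with rfl | ⟨t₀, -⟩
  · refine ⟨0, ?_, fun q => ?_⟩
    · simp
    · simp [Nat.mod_one]
  haveI : Nonempty ι := ⟨t₀⟩
  set PF := (∏ t ∈ s, D t).primeFactors with hPF
  have hD0 : ∀ t ∈ s, D t ≠ 0 := fun t ht => (hsq t ht).ne_zero
  have hprod0 : ∏ t ∈ s, D t ≠ 0 := Finset.prod_ne_zero_iff.2 hD0
  -- every prime of the product divides some modulus: choose one
  have hex : ∀ p ∈ PF, ∃ t ∈ s, p ∣ D t := by
    intro p hp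
    have hpP := Nat.prime_of_mem_primeFactors hp
    have hpd := Nat.dvd_of_mem_primeFactors hp
    exact (Prime.dvd_finsetProd_iff hpP.prime _).1 hpd
  choose! τ hτs hτd using hex
  -- at a prime `p ∈ PF`, all conditions of moduli divisible by `p` are equivalent to the chosen one
  have hkey : ∀ q : ℕ, (∀ t ∈ s, (D t : ℤ) ∣ P t + A t * q) ↔
      ∀ p ∈ PF, ((p : ℕ) : ℤ) ∣ P (τ p) + A (τ p) * q := by
    intro q
    constructor
    · intro h p hp
      exact (Int.natCast_dvd_natCast.2 (hτd p hp)).trans (h (τ p) (hτs p hp))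
    · intro h t ht
      rw [intDvd_iff_forall_primeFactors (hsq t ht)]
      intro p hpt
      have hpP := Nat.prime_of_mem_primeFactors hpt
      have hpDt := Nat.dvd_of_mem_primeFactors hpt
      have hpPF : p ∈ PF := by
        rw [hPF, Nat.mem_primeFactors]
        exact ⟨hpP, hpDt.trans (Finset.dvd_prod_of_mem _ ht), hprod0⟩
      have hAτ : IsCoprime (A (τ p)) (p : ℤ) :=
        (hA (τ p) (hτs p hpPF)).of_isCoprime_of_dvd_right (Int.natCast_dvd_natCast.2 (hτd p hpPF))
      exact intDvd_linear_of_compat hAτ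
        (hcompat p hpP (τ p) (hτs p hpPF) t ht (hτd p hpPF) hpDt) (h p hpPF)
  -- the prime-indexed system has pairwise coprime moduli and unit coefficients
  obtain ⟨c, hc, hiff⟩ := exists_linearSystem_iff_mod_eq PF (fun p => p) (fun p => P (τ p))
    (fun p => A (τ p)) (fun p hp => (Nat.prime_of_mem_primeFactors hp).pos)
    (fun p hp p' hp' hne => (Nat.coprime_primes (Nat.prime_of_mem_primeFactors hp)
      (Nat.prime_of_mem_primeFactors hp')).2 hne)
    (fun p hp => (hA (τ p) (hτs p hp)).of_isCoprime_of_dvd_right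
      (Int.natCast_dvd_natCast.2 (hτd p hp)))
  exact ⟨c, hc, fun q => (hkey q).trans (hiff q)⟩

/-- The radical is the least common multiple in the squarefree case: `R ∣ ∏ D_t` and every
`D_t ∣ R`. [cite: Maynard2016LargeGaps, Lemma 7 (proof, p. 12)] -/
theorem dvd_prod_primeFactors_of_mem {ι : Type*} (s : Finset ι) (D : ι → ℕ)
    (hsq : ∀ t ∈ s, Squarefree (D t)) {t : ι} (ht : t ∈ s) :
    D t ∣ ∏ p ∈ (∏ u ∈ s, D u).primeFactors, p := by
  classical
  have hD0 : ∀ u ∈ s, D u ≠ 0 := fun u hu => (hsq u hu).ne_zero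
  have hprod0 : ∏ u ∈ s, D u ≠ 0 := Finset.prod_ne_zero_iff.2 hD0
  have hsub : (D t).primeFactors ⊆ (∏ u ∈ s, D u).primeFactors := by
    intro p hp
    rw [Nat.mem_primeFactors] at hp ⊢
    exact ⟨hp.1, hp.2.1.trans (Finset.dvd_prod_of_mem _ ht), hprod0⟩
  calc D t = ∏ p ∈ (D t).primeFactors, p := (Nat.prod_primeFactors_of_squarefree (hsq t ht)).symm
    _ ∣ ∏ p ∈ (∏ u ∈ s, D u).primeFactors, p := Finset.prod_dvd_prod_of_subset _ _ _ hsub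

/-- A product of distinct primes is squarefree. [folklore] -/
private theorem squarefree_prod_of_primes (T : Finset ℕ) (hT : ∀ p ∈ T, p.Prime) :
    Squarefree (∏ p ∈ T, p) := by
  classical
  induction T using Finset.induction_on with
  | empty => simp
  | insert a T haT ih =>
    rw [Finset.prod_insert haT]
    have ha := hT a (Finset.mem_insert_self a T)
    have hT' : ∀ p ∈ T, p.Prime := fun p hp => hT p (Finset.mem_insert_of_mem hp)
    refine (Nat.squarefree_mul ?_).2 ⟨ha.squarefree, ih hT'⟩
    exact Nat.Coprime.prod_right fun p hp => (Nat.coprime_primes ha (hT' p hp)).2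
      (fun h => haT (h ▸ hp))

/-- The radical `R` is squarefree and `R ∣ ∏_t D_t`. [cite: Maynard2016LargeGaps, Lemma 7 (proof, p. 12)] -/
theorem squarefree_prod_primeFactors_and_dvd {ι : Type*} (s : Finset ι) (D : ι → ℕ) :
    Squarefree (∏ p ∈ (∏ t ∈ s, D t).primeFactors, p) ∧
      ∏ p ∈ (∏ t ∈ s, D t).primeFactors, p ∣ ∏ t ∈ s, D t :=
  ⟨squarefree_prod_of_primes _ fun _ hp => Nat.prime_of_mem_primeFactors hp,
    Nat.prod_primeFactors_dvd _⟩

end Maynard2016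

end Literature.NumberTheory.Sieve
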